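import Summits.HodgeConjecture.HodgeConjecture.Theses.CyclicUnitaryPowers
import Literature.AlgebraicGeometry.Motives.FermatHypersurface
import Literature.AlgebraicGeometry.Motives.CurveNet
import Literature.AlgebraicGeometry.Motives.HodgeTensorFactsHolds
import Literature.AlgebraicGeometry.HodgeTheory.HodgeFiltrationModelsReductionProofs
import Literature.AlgebraicGeometry.HodgeTheory.ComplexConjugationHolds
import Literature.AlgebraicGeometry.HodgeTheory.DiagonalSymmetry
import Literature.AlgebraicGeometry.HodgeTheory.BettiUniverseIsoTransport

/-!
# K1 transfer step (route `CyclicUnitaryPowers`, item stmt-HodgeConjecture-19544) — models to all members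

Discharges the registered stub `stub_cyclicModelTransfer` (skeleton `63611234fe9f087b`, K1 line
`unitary-reflection-zariski`, active stubs `stub_cyclicDeckModel`, `stub_cyclicPencilEnvelope`,
`stub_unitaryReflectionDensity`, `stub_cdkCover`, `stub_cmsp1537`, `stub_cyclicModelTransfer`) of crux
`VeryGeneralDeckCommutatorsInHg` (rank 2) of route `route-HodgeConjecture-CyclicUnitaryPowers`; landed
`--supports stmt-HodgeConjecture-19544` (it does not close the item). Sorry-free.

## Statement

`stub_cyclicModelTransfer` — stated with the registered signature VERBATIM (the shared `let`-prefix
`pmul`, `ehn`, `Deck`, `Uni`, `Comm` of the route file `Theses/CyclicUnitaryPowers.lean`): if K1 holds for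
the MODELS `X_F = SmoothHypersurface.hypersurface F`, `F = x₃^p − f(x₀,x₁,x₂)`, with the deck transformation
`σ = diagonalAut F ha` of the unit vector `a = (1,1,1,e^{2πi/p}) ∈ diagonalStabilizer F`, then K1 holds as
typed in the route, i.e. for every `X` with `IsHypersurfaceCutOutBy 3 F X`: transport along an
identification `e : X ≅ X_F`.

## Proof

`rootUnits_mem_diagonalStabilizer`: `a = (1,1,1,ζ)`, `ζ = e^{2πi/p}`, stabilises `x₃^p − f(x₀,x₁,x₂)`
(`(ζx₃)^p = x₃^p` as `ζ^p = 1`, and `a` is trivial on `x₀,x₁,x₂`).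
`IsHypersurfaceCutOutBy.nonempty_iso_hypersurface` gives `e : X ≅ X_F`; `IsSmoothProjective.of_iso`
makes `X_F` smooth projective; put `σ := e ≫ diagonalAut F ha ≫ e⁻¹`. The four clauses of `Deck` and the
clause `Comm` transport along `e` by the kit `HodgeTheory/BettiUniverseIsoTransport`:
(i) `(σ^*)^p = 1` — `pull_conj_pow_of_iso` (conjugation is multiplicative, proved here for all powers);
(ii) `tr(σ^*x ∪ σ^*y) = tr(x ∪ y)` — `tr_cup_pull_conj_of_iso`;
(iii) `dim_ℚ E₁(σ^*) = 1` — `finrank_eigenspace_pull_conj_of_iso` (the rational eigenspace of the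
conjugate is the pull-back of that of `σ'^*` along `(e⁻¹)^*`, proved here);
(iv) the eigen-Hodge numbers `dim_ℂ (E_{ζ^j}(σ^*_ℂ) ∩ H^{2−q,q})` — `finrank_eigenspace_inf_piece_eq_of_iso`
(same `ζ`);
`Comm` — `comm_of_iso` (Hodge groups and `σ`-unitary commutators correspond under `(e⁻¹)^*`).

## References

* [HatcherAT2002] A. Hatcher, Algebraic Topology, CUP 2002, §3.1 p. 198, §3.3 Thm. 3.26.
* [VoisinHodgeI2002] C. Voisin, Hodge Theory and Complex Algebraic Geometry I, CUP 2002, §7.3.2.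
* [Deligne1982HodgeCycles] P. Deligne, Hodge cycles on abelian varieties, LNM 900 (1982), I Prop. 3.4.
* [Katz2009] N. M. Katz, Another look at the Dwork family, in: Algebra, Arithmetic, and Geometry,
  Progr. Math. 270 (2009), §3.
-/

noncomputable section

namespace Summit.HodgeConjecture.HodgeConjecture.Theorems.CyclicUnitaryPowersModelTransfer

open Literature.AlgebraicGeometry.Motives Literature.AlgebraicGeometry.HodgeTheory
open Literature.AlgebraicGeometry.HodgeTheory.BettiUniverse
open Literature.AlgebraicTopology.SingularHomology
open CategoryTheory

section Transport

variable {X X' : SchemeOver ℂ}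

/-- **Powers transport under conjugation**: `((e ≫ σ' ≫ e⁻¹)^*)^m = e^* ∘ (σ'^*)^m ∘ (e⁻¹)^*` on
`Hᵏ(X(ℂ); ℚ)` (`(e⁻¹)^* ∘ e^* = id`). [cite: HatcherAT2002, §3.1 p. 198] -/
theorem pull_conj_pow_of_iso (e : X ≅ X') (σ' : X' ⟶ X') (k m : ℕ) :
    pull (e.hom ≫ σ' ≫ e.inv) k ^ m = pull e.hom k ∘ₗ (pull σ' k ^ m) ∘ₗ pull e.inv k := by
  induction m with
  | zero =>
    rw [pow_zero, pow_zero]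
    refine LinearMap.ext fun x ↦ ?_
    rw [Module.End.one_apply, LinearMap.comp_apply, LinearMap.comp_apply, Module.End.one_apply,
      pull_hom_pull_inv_apply]
  | succ m ih =>
    rw [pow_succ, pow_succ, ih, pull_conj_of_iso]
    refine LinearMap.ext fun x ↦ ?_
    simp only [Module.End.mul_apply, LinearMap.comp_apply, pull_inv_pull_hom_apply]

/-- **Clause (i) of `Deck` transports**: `(σ'^*)^m = 1 ⇒ ((e ≫ σ' ≫ e⁻¹)^*)^m = 1` on `Hᵏ`.
[cite: HatcherAT2002, §3.1 p. 198] -/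
theorem pull_conj_pow_eq_one_of_iso (e : X ≅ X') {σ' : X' ⟶ X'} {k m : ℕ} (h : pull σ' k ^ m = 1) :
    pull (e.hom ≫ σ' ≫ e.inv) k ^ m = 1 := by
  rw [pull_conj_pow_of_iso, h]
  refine LinearMap.ext fun x ↦ ?_
  rw [LinearMap.comp_apply, LinearMap.comp_apply, Module.End.one_apply, pull_hom_pull_inv_apply,
    Module.End.one_apply]

/-- The rational `μ`-eigenspace of the conjugate `(e ≫ σ' ≫ e⁻¹)^*` is the pull-back of that of `σ'^*`
along `(e⁻¹)^* = pullEquiv e k`. [cite: HatcherAT2002, §3.1 p. 198] -/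
theorem eigenspace_pull_conj_eq_comap_rat (e : X ≅ X') (σ' : X' ⟶ X') (k : ℕ) (μ : ℚ) :
    Module.End.eigenspace (pull (e.hom ≫ σ' ≫ e.inv) k) μ =
      (Module.End.eigenspace (pull σ' k) μ).comap (pullEquiv e k : bettiCohomology X k →ₗ[ℚ] bettiCohomology X' k) := by
  ext x
  simp only [Submodule.mem_comap, Module.End.mem_eigenspace_iff, pull_conj_of_iso_apply,
    LinearEquiv.coe_coe, pullEquiv_apply]
  constructor
  · intro h
    have h' := congrArg (pull e.inv k) h
    rwa [pull_inv_pull_hom_apply, map_smul] at h'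
  · intro h
    rw [h, map_smul, pull_hom_pull_inv_apply]

/-- **Clause (iii) of `Deck` transports**: `dim_ℚ E_μ((e ≫ σ' ≫ e⁻¹)^*) = dim_ℚ E_μ(σ'^*)` on `Hᵏ`.
[cite: HatcherAT2002, §3.1 p. 198] -/
theorem finrank_eigenspace_pull_conj_of_iso (e : X ≅ X') (σ' : X' ⟶ X') (k : ℕ) (μ : ℚ) :
    Module.finrank ℚ ↥(Module.End.eigenspace (pull (e.hom ≫ σ' ≫ e.inv) k) μ) =
      Module.finrank ℚ ↥(Module.End.eigenspace (pull σ' k) μ) := by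
  rw [eigenspace_pull_conj_eq_comap_rat, Submodule.comap_equiv_eq_map_symm]
  exact LinearEquiv.finrank_map_eq _ _

end Transport

/-- **The unit vector `(1,1,1,e^{2πi/p})` stabilises `x₃^p − f(x₀,x₁,x₂)`** (`p ≠ 0`): the membership
`ha` of the K1 line `unitary-reflection-zariski`, `stub_cyclicDeckModel` / `stub_cyclicModelTransfer`.
[cite: Katz2009, §3] -/
theorem rootUnits_mem_diagonalStabilizer {p : ℕ} (hp : p ≠ 0) (f : MvPolynomial (Fin 3) ℂ) :
    (fun i : Fin 4 => if i = Fin.last 3 then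
        (Units.mk0 (Complex.exp (2 * (Real.pi : ℂ) * Complex.I / (p : ℂ))) (Complex.exp_ne_zero _))
      else 1) ∈
      diagonalStabilizer (MvPolynomial.X (Fin.last 3) ^ p - MvPolynomial.rename Fin.castSucc f) := by
  set a : Fin 4 → ℂˣ := fun i : Fin 4 => if i = Fin.last 3 then
      (Units.mk0 (Complex.exp (2 * (Real.pi : ℂ) * Complex.I / (p : ℂ))) (Complex.exp_ne_zero _))
    else 1 with ha_def
  have hζp : Complex.exp (2 * (Real.pi : ℂ) * Complex.I / (p : ℂ)) ^ p = 1 := by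
    rw [← Complex.exp_nat_mul, mul_div_cancel₀ _ (Nat.cast_ne_zero.2 hp), Complex.exp_two_pi_mul_I]
  have hlast : ((a (Fin.last 3) : ℂˣ) : ℂ) = Complex.exp (2 * (Real.pi : ℂ) * Complex.I / (p : ℂ)) := by
    rw [ha_def]; simp
  have hsub : (fun j : Fin 3 => diagonalSubst (n := 2) a (Fin.castSucc j)) =
      fun j : Fin 3 => MvPolynomial.X (Fin.castSucc j) := by
    funext j
    have hj : Fin.castSucc j ≠ Fin.last 3 := (Fin.castSucc_lt_last j).ne
    rw [diagonalSubst_apply, ha_def]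
    dsimp only
    rw [if_neg hj, Units.val_one, map_one, one_mul]
  rw [mem_diagonalStabilizer_iff, map_sub, map_pow, MvPolynomial.aeval_X, diagonalSubst_apply, hlast,
    MvPolynomial.aeval_rename, mul_pow, ← MvPolynomial.C_pow, hζp, MvPolynomial.C_1, one_mul]
  congr 1
  change MvPolynomial.aeval (fun j : Fin 3 => diagonalSubst (n := 2) a (Fin.castSucc j)) f = _
  rw [hsub, MvPolynomial.rename_eq_aeval]
  rfl

/-- **`stub_cyclicModelTransfer`** (registered signature verbatim): K1 for the models `X_F`,
`F = x₃^p − f`, with the canonical deck transformation `diagonalAut F ha`, implies K1 as typed in the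
route (`VeryGeneralDeckCommutatorsInHg`). [cite: HatcherAT2002, §3.1 p. 198 and §3.3 Thm. 3.26]
[cite: VoisinHodgeI2002, §7.3.2] [cite: Deligne1982HodgeCycles, I Prop. 3.4] -/
theorem stub_cyclicModelTransfer :
    open Literature.AlgebraicGeometry.Motives Literature.AlgebraicGeometry.HodgeTheory Literature.AlgebraicGeometry.HodgeTheory.BettiUniverse CategoryTheory.Limits in let pmul : List ℕ → List ℕ → List ℕ := fun a b => (List.range (a.length + b.length - 1)).map fun k => ((List.range (k + 1)).map fun i => a.getD i 0 * b.getD (k - i) 0).sum; let ehn : ℕ → ℕ → ℕ → ℕ := fun p j q => if (q + 1) * p < 3 + j then 0 else ((List.replicate 3 (List.replicate (p - 1) 1)).foldl pmul [1]).getD ((q + 1) * p - 3 - j) 0; let Deck : (p : ℕ) → (X : SchemeOver ℂ) → IsSmoothProjective 2 X → (X ⟶ X) → Prop := fun p X hX σ => pull σ 2 ^ p = 1 ∧ (∀ x y, tr hX (2 + 2) (cup X 2 2 (pull σ 2 x) (pull σ 2 y)) = tr hX (2 + 2) (cup X 2 2 x y)) ∧ Module.finrank ℚ ↥(Module.End.eigenspace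 (pull σ 2) 1) = 1 ∧ ∃ ζ : ℂ, IsPrimitiveRoot ζ p ∧ ∀ j q : ℕ, 1 ≤ j → j < p → q ≤ 2 → Module.finrank ℂ ↥(Module.End.eigenspace ((pull σ 2).baseChange ℂ) (ζ ^ j) ⊓ (hodge exists_isReal_hodgeModel_holds hX 2).piece ((2 : ℤ) - q) q) = ehn p j q; let Uni : (X : SchemeOver ℂ) → IsSmoothProjective 2 X → (X ⟶ X) → (bettiCohomology X 2 ≃ₗ[ℚ] bettiCohomology X 2) → Prop := fun X hX σ g => (∀ x, g (pull σ 2 x) = pull σ 2 (g x)) ∧ ∀ x y, tr hX (2 + 2) (cup X 2 2 (g x) (g y)) = tr hX (2 + 2) (cup X 2 2 x y); let Comm : (X : SchemeOver ℂ) → IsSmoothProjective 2 X → (X ⟶ X) → Prop := fun X hX σ => haveI := finite hX 2; haveI : HodgeTensorFacts.{0, 0} := hodgeTensorFacts_holds; ∀ g h : bettiCohomology X 2 ≃ₗ[ℚ] bettiCohomology X 2, Uni X hX σ g → Uni X hX σ h → g * h * g⁻¹ * h⁻¹ ∈ (hodge exists_isReal_hodgeModel_holds hX 2).hodgeGroup;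 (∀ ⦃p : ℕ⦄, p.Prime → 7 ≤ p → ∃ g : ℕ → MvPolynomial {d : Fin 3 →₀ ℕ // d.degree = p} ℂ, (∀ i, ∃ f : MvPolynomial (Fin 3) ℂ, f.IsHomogeneous p ∧ MvPolynomial.eval (fun d : {d : Fin 3 →₀ ℕ // d.degree = p} => f.coeff d.1) (g i) ≠ 0) ∧ ∀ f : MvPolynomial (Fin 3) ℂ, f.IsHomogeneous p → (∀ i, MvPolynomial.eval (fun d : {d : Fin 3 →₀ ℕ // d.degree = p} => f.coeff d.1) (g i) ≠ 0) → ∀ (hXF : IsSmoothProjective 2 (SmoothHypersurface.hypersurface (MvPolynomial.X (Fin.last 3) ^ p - MvPolynomial.rename Fin.castSucc f))) (ha : (fun i : Fin 4 => if i = Fin.last 3 then (Units.mk0 (Complex.exp (2 * (Real.pi : ℂ) * Complex.I / (p : ℂ))) (Complex.exp_ne_zero _)) else 1) ∈ diagonalStabilizer (MvPolynomial.X (Fin.last 3) ^ p - MvPolynomial.rename Fin.castSucc f)), Deck p (SmoothHypersurface.hypersurface (MvPolynomial.X (Fin.last 3) ^ p - MvPolynomial.rename Fin.castSucc f)) hXF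 (diagonalAut (MvPolynomial.X (Fin.last 3) ^ p - MvPolynomial.rename Fin.castSucc f) ha) ∧ Comm (SmoothHypersurface.hypersurface (MvPolynomial.X (Fin.last 3) ^ p - MvPolynomial.rename Fin.castSucc f)) hXF (diagonalAut (MvPolynomial.X (Fin.last 3) ^ p - MvPolynomial.rename Fin.castSucc f) ha)) → Summit.HodgeConjecture.HodgeConjecture.Theses.CyclicUnitaryPowers.VeryGeneralDeckCommutatorsInHg := by
  intro pmul ehn Deck Uni Comm hModel p hp h7
  obtain ⟨g, hg, hmain⟩ := hModel hp h7
  refine ⟨g, hg, fun f hf hgen X hX hcut ↦ ?_⟩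
  obtain ⟨e⟩ := hcut.nonempty_iso_hypersurface
  have hXF : IsSmoothProjective 2 (SmoothHypersurface.hypersurface
      (MvPolynomial.X (Fin.last 3) ^ p - MvPolynomial.rename Fin.castSucc f)) := hX.of_iso e
  have ha := rootUnits_mem_diagonalStabilizer hp.ne_zero f
  obtain ⟨hDeck, hComm⟩ := hmain f hf hgen hXF ha
  dsimp only [Deck, Uni, Comm] at hDeck hComm ⊢
  obtain ⟨h1, h2, h3, ζ, hζ, h4⟩ := hDeck
  refine ⟨e.hom ≫ diagonalAut _ ha ≫ e.inv, ⟨pull_conj_pow_eq_one_of_iso e h1,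
    tr_cup_pull_conj_of_iso hX hXF e h2, ?_, ζ, hζ, fun j q hj hjp hq ↦ ?_⟩, ?_⟩
  · rw [finrank_eigenspace_pull_conj_of_iso]
    exact h3
  · rw [finrank_eigenspace_inf_piece_eq_of_iso exists_isReal_hodgeModel_holds
      hodgePQ_independent_of_hodgeModel_holds hX hXF e (diagonalAut _ ha) 2]
    exact h4 j q hj hjp hq
  · haveI : HodgeTensorFacts.{0, 0} := hodgeTensorFacts_holds
    exact comm_of_iso exists_isReal_hodgeModel_holds hodgePQ_independent_of_hodgeModel_holds hX hXF e
      (diagonalAut _ ha) 2 hComm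

end Summit.HodgeConjecture.HodgeConjecture.Theorems.CyclicUnitaryPowersModelTransfer
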